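import Literature.IUT.HodgeTheaters.GenuineFKitOfBadLocalNV
import Literature.IUT.HodgeTheaters.GenuineFKitOfBadLocalTemperedSideNV
import HarnessLib

/-!
# R59 «MERGEINPUTS-NV» CLOSED AT ONE EXPLICIT DATUM: the merge record `MergeInputs D B` of the genuine `ℱ`-kit is INHABITED at the
# `X̲→`-profinite stand-in `B := badPairAtArrow hA`, modulo FACT F-0240 only — and there it is inhabited IFF F-0240 (proof-only knit)

S. Mochizuki, *Inter-universal Teichmüller theory I*, kurims manuscript (May 2020), Def. 3.1 (e)(f) pp. 62–63, Example 3.2 (i)–(v)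
pp. 69–73, Def. 5.2 (i)–(iv) pp. 134–135 ([IUTchI] Def 5.2 (i) p.134) [claim: Mochizuki2012, status: disputed] (D-0012 claim key, series
status DISPUTED — a composition of landed theorems over abc-iut-L5-t2's REAL `InitialThetaData`; nothing of the series is asserted; no side
is taken on [IUTchIII] Cor. 3.12).

PURPOSE (abc-iut cell, L5 hub; L5-lead RULINGS #119 (2) flip condition (b) for the «mod I» Ex. 3.2 candidates, row R59; RULINGS #121 (1)
target statement «`Nonempty (MergeInputs D … B …)` … at ONE explicit datum»).  The two halves are LANDED: (m2)+(m4) by abc-iut-L5-t2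
(`GenuineFKitOfBadLocalNV`: `m2StandIn` with GENUINE augmentation and degenerate `Ÿ`, `realifiedGlobalSideOfModuli`, and the record
modulo the (m1) residual `MergeInputsNVResidual` / `nonempty_mergeInputs_standIn_of_residual`), and (m1) over EVERY group datum by
abc-iut-L5-t3 (`GenuineFKitOfBadLocalTemperedSideNV`: `badTemperedSideModel` = the sum model, `MergeInputs.ofGroupDataModuli`,
`nonempty_mergeInputs_iff`).  THIS FILE is the 1-step knit, BY NAME, proof-only (0 def):
* `nonempty_mergeInputsNVResidual` — abc-iut-L5-t2's (m1) residual at the stand-in IS inhabited, by abc-iut-L5-t3's model;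
* `nonempty_mergeInputs_standIn` — **`Nonempty (D.MergeInputs fun v _ => D.badPairAtArrow hA v)`** from {`hA`, `CG`} and FACT F-0240 `GeomTFG`
  (route t3: `nonempty_mergeInputs_of_groupData` at `m2StandIn`); `nonempty_mergeInputs_standIn'` (route t2: residual) — the two routes agree;
* `nonempty_mergeInputs_standIn_iff_geomTFG` — at the stand-in the merge record is inhabited **iff** F-0240 holds (the record CARRIES `geomTFG`;
  conversely F-0240 ⇒ [IUTchI] §1 openness `ArrowOpenClaims` (abc-iut-L5-t2 `arrowOpenClaims_pe_of_geomTFG`) ⇒ `m2StandIn`);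
* the slots of the explicit record `MergeInputs.ofGroupDataModuli D _ (m2StandIn …) hTFG` read back (`rfl`): (m2) = `m2StandIn`, (m1) = the sum
  model, (m4) = `𝒞⊩_mod`.
LABELS (carried verbatim): «[m2 MODEL at the `X̲→`-stand-in: aug genuine, `Ÿ` degenerate; NOT the tempered `Π^tp_{X̳_v̲} ⊇ Π^tp_{Ÿ_v̲}` of print]»,
«[m1 MODEL: sum carrier, `Θ := 1`]», (m4) genuine `𝒞⊩_mod`.  BINDER CENSUS: {`D`, `hA`, `CG`} (kit binders) + FACT F-0240 `hTFG` by name;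
LAW 0; 0 def · 0 instance · 0 notation · no `Prop` fact · nothing restated.  An inhabitant shows the binder set is jointly satisfiable —
nothing more; typed ≠ inhabited ≠ proved; nothing here asserts abc proved or refuted.
-/

noncomputable section

namespace Literature.IUT.HodgeTheaters

open CategoryTheory

variable {F K Fbar : Type} [Field F] [NumberField F] [Field K] [NumberField K] [Algebra F K]
  [Field Fbar] [Algebra F Fbar] [Algebra K Fbar] {E : WeierstrassCurve F}
  [E.IsElliptic] {l : ℕ} {Pb : BadPlacePredicates K} (D : InitialThetaData F K Fbar E l Pb)

namespace InitialThetaData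

/-- **abc-iut-L5-t2's (m1) residual at the stand-in IS inhabited** — by abc-iut-L5-t3's sum model `badTemperedSideModel` over the group
datum `m2StandIn` at every bad index («[m1 MODEL …]»). ([IUTchI] Ex 3.2 (i) p.70) [claim: Mochizuki2012, status: disputed] -/
theorem nonempty_mergeInputsNVResidual (hA : D.geom.pe.ArrowCoveringClaims) (CG : D.geom.pe.CuspGalois) (hTFG : D.geom.extF.GeomTFG) :
    Nonempty (D.MergeInputsNVResidual hA CG hTFG) :=
  ⟨fun x hx => D.badTemperedSideModel (fun v _ => D.badPairAtArrow hA v) x hx _⟩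

/-- **R59 CLOSED AT THE `X̲→`-STAND-IN: the merge record is INHABITED** — `Nonempty (MergeInputs D (badPairAtArrow hA))` from the kit's own
{`hA`, `CG`} and FACT F-0240 `GeomTFG`: (m2) abc-iut-L5-t2's `m2StandIn` (genuine augmentation, degenerate `Ÿ`), (m1) abc-iut-L5-t3's sum
model, (m4) `𝒞⊩_mod` — abc-iut-L5-t3's `nonempty_mergeInputs_of_groupData` at abc-iut-L5-t2's group data, BY NAME.
([IUTchI] Def 5.2 (i) p.134) [claim: Mochizuki2012, status: disputed] -/
theorem nonempty_mergeInputs_standIn (hA : D.geom.pe.ArrowCoveringClaims) (CG : D.geom.pe.CuspGalois) (hTFG : D.geom.extF.GeomTFG) :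
    Nonempty (D.MergeInputs fun v _ => D.badPairAtArrow hA v) :=
  D.nonempty_mergeInputs_of_groupData (fun v _ => D.badPairAtArrow hA v)
    (fun x hx =>
      haveI : Fact (D.primeAt x (D.not_mem_arc_of_mem_bad hx)).Prime := D.fact_primeAt_prime x _
      D.m2StandIn hA CG hTFG x (D.not_mem_arc_of_mem_bad hx))
    hTFG

/-- The same along abc-iut-L5-t2's route (record modulo the residual, residual inhabited) — the two routes agree.
([IUTchI] Def 5.2 (i) p.134) [claim: Mochizuki2012, status: disputed] -/
theorem nonempty_mergeInputs_standIn' (hA : D.geom.pe.ArrowCoveringClaims) (CG : D.geom.pe.CuspGalois) (hTFG : D.geom.extF.GeomTFG) :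
    Nonempty (D.MergeInputs fun v _ => D.badPairAtArrow hA v) :=
  D.nonempty_mergeInputs_standIn_of_residual hA CG hTFG (D.nonempty_mergeInputsNVResidual hA CG hTFG)

/-- **At the `X̲→`-stand-in the merge record is inhabited IFF FACT F-0240 `GeomTFG` holds** (given the kit's `hA`, `CG`): the record carries
`geomTFG`; conversely F-0240 gives the [IUTchI] §1 openness behind `m2StandIn` and the models fill (m1), (m4).
([IUTchI] Def 5.2 (i) p.134) [claim: Mochizuki2012, status: disputed] -/
theorem nonempty_mergeInputs_standIn_iff_geomTFG (hA : D.geom.pe.ArrowCoveringClaims) (CG : D.geom.pe.CuspGalois) :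
    Nonempty (D.MergeInputs fun v _ => D.badPairAtArrow hA v) ↔ D.geom.extF.GeomTFG :=
  ⟨fun ⟨I⟩ => I.geomTFG, fun h => D.nonempty_mergeInputs_standIn hA CG h⟩

/-- The (m2) slot of the explicit record at the stand-in is `m2StandIn` (read-back, `rfl`). ([IUTchI] Ex 3.2 (i) p.70) [claim: Mochizuki2012, status: disputed] -/
theorem mergeInputs_standIn_m2 (hA : D.geom.pe.ArrowCoveringClaims) (CG : D.geom.pe.CuspGalois) (hTFG : D.geom.extF.GeomTFG)
    (x : D.IndexCopy) (hx : x ∈ D.indexCopyBad) :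
    (MergeInputs.ofGroupDataModuli D (fun v _ => D.badPairAtArrow hA v)
        (fun x hx =>
          haveI : Fact (D.primeAt x (D.not_mem_arc_of_mem_bad hx)).Prime := D.fact_primeAt_prime x _
          D.m2StandIn hA CG hTFG x (D.not_mem_arc_of_mem_bad hx))
        hTFG).m2 x hx =
      (haveI : Fact (D.primeAt x (D.not_mem_arc_of_mem_bad hx)).Prime := D.fact_primeAt_prime x _
       D.m2StandIn hA CG hTFG x (D.not_mem_arc_of_mem_bad hx)) := rfl

/-- The (m1) slot of the explicit record at the stand-in is abc-iut-L5-t3's sum model over `m2StandIn` (read-back, `rfl`).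
([IUTchI] Ex 3.2 (i) p.70) [claim: Mochizuki2012, status: disputed] -/
theorem mergeInputs_standIn_m1 (hA : D.geom.pe.ArrowCoveringClaims) (CG : D.geom.pe.CuspGalois) (hTFG : D.geom.extF.GeomTFG)
    (x : D.IndexCopy) (hx : x ∈ D.indexCopyBad) :
    (MergeInputs.ofGroupDataModuli D (fun v _ => D.badPairAtArrow hA v)
        (fun x hx =>
          haveI : Fact (D.primeAt x (D.not_mem_arc_of_mem_bad hx)).Prime := D.fact_primeAt_prime x _
          D.m2StandIn hA CG hTFG x (D.not_mem_arc_of_mem_bad hx))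
        hTFG).m1 x hx =
      D.badTemperedSideModel (fun v _ => D.badPairAtArrow hA v) x hx _ := rfl

/-- The (m4) slot of the explicit record at the stand-in is the GENUINE `𝒞⊩_mod` (read-back, `rfl`). ([IUTchI] Ex 3.5 (i) p.84) [claim: Mochizuki2012, status: disputed] -/
theorem mergeInputs_standIn_m4 (hA : D.geom.pe.ArrowCoveringClaims) (CG : D.geom.pe.CuspGalois) (hTFG : D.geom.extF.GeomTFG) :
    (MergeInputs.ofGroupDataModuli D (fun v _ => D.badPairAtArrow hA v)
        (fun x hx =>
          haveI : Fact (D.primeAt x (D.not_mem_arc_of_mem_bad hx)).Prime := D.fact_primeAt_prime x _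
          D.m2StandIn hA CG hTFG x (D.not_mem_arc_of_mem_bad hx))
        hTFG).m4 = D.realifiedGlobalSideOfModuli := rfl

end InitialThetaData

end Literature.IUT.HodgeTheaters

end
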